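import Summits.AnomalousDissipation.AnomalousDissipation.Theorems.CubicParityLoud.Negative.EnergyRow
import Summits.AnomalousDissipation.AnomalousDissipation.Theorems.MomentParityQuarticGateBasis
import Literature.Analysis.FluidPDE.CylindricalGenerator
import Literature.Analysis.FluidPDE.StatisticalSolutionProofs

/-!
# Helpers for the stub `stub_noCasimirCertificate` (S4) of the line `farkas-split-menu`
# (crux `MomentParity.CubicParityLoud`, stmt-AnomalousDissipation-11465): scaling and integration

Bookkeeping used by `Theorems/MomentParityCubicParityLoudNoCasimirCertificate.lean`:

* `quad_coeff_nonpos`, `lin_coeff_eq_zero` — a real quadratic (affine) function bounded above by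
  `0` on `ℝ` has non-positive leading (zero linear) coefficient;
* `nsGeneratorPairing_lincomb₃`, `nsGeneratorPairing_smul_test`, `nsGeneratorPairing_zero_zero` —
  linearity of the tested generator `⟨F_ν(u), w⟩` in the smooth test `w`, and its Euler case
  `⟨F₀(u), w⟩ = ∫ (u ⊗ u) : ∇w`;
* `nsGeneratorPairing_smul_left`, `isLevel_smul` — SCALING `u ↦ t • u` in `H`:
  `⟨F_ν(tu), w⟩ = (f, w) + t ν(u, Δw) + t² ∫ (u ⊗ u) : ∇w`, and `t • u` stays at level `N`;
* `isBandTest_sum_smul` — constant combinations of band tests are band tests;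
* `certificate_integral` — integrating a pointwise certificate
  `R₀ + 2α dE + 2β dH + λ_b(A − ‖u‖²) + λ_c(ν‖∇u‖² − ε) ≤ 0` against a level-`N` probability law
  with `‖u‖³ ∈ L¹` and `∫ R₀ = 0` gives `2α∫dE + 2β∫dH + λ_b(A − energy) + λ_c(dissipation − ε) ≤ 0`
  (Bernstein `‖∇u‖² ≤ 4π²N²‖u‖²` on level-`N` fields makes the enstrophy term a Bochner integral).
-/

noncomputable section

-- `Summit.<Summit>.<Problem>` is the tree's mandated summit-side namespace (CONVENTIONS §2);
-- the duplicate is deliberate.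
set_option linter.dupNamespace false

namespace Summit.AnomalousDissipation.AnomalousDissipation.Theorems.MomentParityCubicParityLoud

open MeasureTheory Filter UnitAddTorus
open scoped InnerProductSpace RealInnerProductSpace ENNReal
open Literature.Analysis.FunctionSpaces Literature.Analysis.FluidPDE
open Summit.AnomalousDissipation.AnomalousDissipation.Theses.MomentParity
open Summit.AnomalousDissipation.AnomalousDissipation.Theorems.CubicParityLoud.Negative

namespace NoCasimirCertificate

/-! ## Elementary real lemmas -/

/-- A real quadratic `a + bt + ct²` that is `≤ 0` for every `t` has `c ≤ 0`. -/
theorem quad_coeff_nonpos {a b c : ℝ} (h : ∀ t : ℝ, a + b * t + c * t ^ 2 ≤ 0) :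
    c ≤ 0 := by
  by_contra hc
  have hc : 0 < c := lt_of_not_ge hc
  set t : ℝ := |a| / c + 1 with ht
  have h1 := h t
  have h2 := h (-t)
  have h0 : 0 ≤ |a| / c := div_nonneg (abs_nonneg a) hc.le
  have ht1 : 1 ≤ t := by linarith
  have hct : c * t = |a| + c := by
    rw [ht, mul_add, mul_one, mul_div_cancel₀ _ hc.ne']
  have habs : -a ≤ |a| := neg_le_abs a
  have hsum : 2 * a + 2 * (c * t ^ 2) ≤ 0 := by nlinarith
  have htt : t ≤ t ^ 2 := by
    have h' : t * 1 ≤ t * t := mul_le_mul_of_nonneg_left ht1 (zero_le_one.trans ht1)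
    rw [mul_one, ← sq] at h'
    exact h'
  have hlow : c * t ≤ c * t ^ 2 := mul_le_mul_of_nonneg_left htt hc.le
  nlinarith

/-- A real affine function `a + bt` that is `≤ 0` for every `t` has `b = 0`. -/
theorem lin_coeff_eq_zero {a b : ℝ} (h : ∀ t : ℝ, a + b * t ≤ 0) : b = 0 := by
  by_contra hb
  have h1 := h ((|a| + 1) / b)
  rw [mul_div_cancel₀ _ hb] at h1
  have := neg_abs_le a
  linarith

/-! ## The tested generator: linear combinations of tests, the Euler case, scaling in `u` -/

/-- Linearity of `⟨F_ν(u), ·⟩` over a three-term combination of smooth tests. -/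
theorem nsGeneratorPairing_lincomb₃ (ν : ℝ) {f : T3 → R3} (hf : Integrable f volume) (u : H3)
    (a b c : ℝ) {v₁ v₂ v₃ : T3 → R3} (h₁ : Torus.IsSmooth v₁)
    (h₂ : Torus.IsSmooth v₂) (h₃ : Torus.IsSmooth v₃) :
    Torus.nsGeneratorPairing ν f u (fun x => a • v₁ x + b • v₂ x + c • v₃ x) =
      a * Torus.nsGeneratorPairing ν f u v₁ + b * Torus.nsGeneratorPairing ν f u v₂ +
        c * Torus.nsGeneratorPairing ν f u v₃ := by
  have h := Torus.nsGeneratorPairing_sum_smul ν hf u Finset.univ ![a, b, c]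
    (g := ![v₁, v₂, v₃]) (fun i _ => by fin_cases i <;> assumption)
  simpa [Fin.sum_univ_three, add_assoc] using h

/-- Homogeneity of `⟨F_ν(u), ·⟩` in a smooth test field:
`⟨F_ν(u), c w⟩ = c ⟨F_ν(u), w⟩`. -/
theorem nsGeneratorPairing_smul_test (ν : ℝ) {f : T3 → R3} (hf : Integrable f volume) (u : H3)
    (c : ℝ) {w : T3 → R3} (hw : Torus.IsSmooth w) :
    Torus.nsGeneratorPairing ν f u (fun x => c • w x) =
      c * Torus.nsGeneratorPairing ν f u w := by
  have h := Torus.nsGeneratorPairing_sum_smul ν hf u Finset.univ (fun _ : Fin 1 => c)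
    (g := fun _ => w) (fun _ _ => hw)
  simpa using h

/-- The Galerkin–Euler case: `nsGeneratorPairing 0 0 u w = ∫ (u ⊗ u) : ∇w`. -/
theorem nsGeneratorPairing_zero_zero (u : H3) (w : T3 → R3) :
    Torus.nsGeneratorPairing (d := Fin 3) 0 0 u w = Torus.inertialPairing (u : L2T3) w := by
  unfold Torus.nsGeneratorPairing
  simp

/-- **Scaling in `u`** (registered sub-goal of `stub_noCasimirCertificate`):
`⟨F_ν(tu), w⟩ = (f, w) + t · ν(u, Δw) + t² · ∫ (u ⊗ u) : ∇w`. -/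
theorem nsGeneratorPairing_smul_left :
    ∀ (ν : ℝ) (f : T3 → R3) (u : H3) (t : ℝ) (w : T3 → R3),
      Torus.nsGeneratorPairing ν f (t • u) w =
        (∫ x, ⟪f x, w x⟫_ℝ) +
          t * (ν * ∫ x, ⟪((u : L2T3) : T3 → R3) x, Torus.laplacian w x⟫_ℝ) +
            t ^ 2 * Torus.inertialPairing (u : L2T3) w := by
  intro ν f u t w
  have hae : (((t • u : H3) : L2T3) : T3 → R3) =ᵐ[volume]
      fun x => t • ((u : L2T3) : T3 → R3) x := by
    rw [Submodule.coe_smul]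
    exact Lp.coeFn_smul t (u : L2T3)
  have h1 : ∫ x, ⟪(((t • u : H3) : L2T3) : T3 → R3) x, Torus.laplacian w x⟫_ℝ =
      t * ∫ x, ⟪((u : L2T3) : T3 → R3) x, Torus.laplacian w x⟫_ℝ := by
    rw [← integral_const_mul]
    refine integral_congr_ae (hae.mono fun x hx => ?_)
    simp only [hx, real_inner_smul_left]
  have h2 : Torus.inertialPairing ((t • u : H3) : L2T3) w =
      t ^ 2 * Torus.inertialPairing (u : L2T3) w := by
    unfold Torus.inertialPairing
    rw [← integral_const_mul]
    refine integral_congr_ae (hae.mono fun x hx => ?_)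
    simp only [hx, map_smul, real_inner_smul_left, real_inner_smul_right]
    ring
  unfold Torus.nsGeneratorPairing
  rw [h1, h2]
  unfold Torus.inertialPairing
  ring

/-- A real multiple of a level-`N` field is level-`N`. -/
-- adapted from `MomentParityQuarticGateAtoms.level_smul`
theorem isLevel_smul {N : ℕ} (t : ℝ) {u : H3} (hu : IsLevel N u) : IsLevel N (t • u) := by
  intro k hk
  have hae : (((t • u : H3) : L2T3) : T3 → R3) =ᵐ[volume]
      fun x => t • ((u : L2T3) : T3 → R3) x := by
    rw [Submodule.coe_smul]
    exact Lp.coeFn_smul t (u : L2T3)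
  rw [Torus.mFourierCoeff_congr_ae (hae.fun_comp EuclideanSpace.complexify) k,
    MomentParityQuarticGate.mFourierCoeff_complexify_smul, hu k hk, smul_zero]

/-! ## Constant combinations of band tests -/

/-- A constant real combination of level-`N` band tests is a level-`N` band test. -/
theorem isBandTest_sum_smul {N m : ℕ} {g : Fin m → T3 → R3} (hg : ∀ i, IsBandTest N (g i))
    (c : Fin m → ℝ) : IsBandTest N (fun x => ∑ i, c i • g i x) := by
  refine ⟨Torus.IsSmooth.sum_smul Finset.univ c fun i => (hg i).1,
    Torus.IsDivFree.sum_smul Finset.univ c (fun i => (hg i).1) fun i => (hg i).2.1,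
    Torus.HasZeroMean.sum_smul Finset.univ c (fun i => (hg i).1.integrable) fun i => (hg i).2.2.1,
    fun k hk => ?_⟩
  rw [MomentParityQuarticGate.mFourierCoeff_complexify_sum_smul Finset.univ c
    (fun i => (hg i).1.continuous) k]
  exact Finset.sum_eq_zero fun i _ => by rw [(hg i).2.2.2 k hk, smul_zero]

/-! ## Integrating a certificate against a level-`N` law -/

/-- **Integration of the certificate.** For a probability law carried by level-`N` fields with
`‖u‖³` integrable, a residual row `R₀` of zero mean and integrable drifts `dE`, `dH`: if
`R₀ + 2α dE + 2β dH + λ_b(A − ‖u‖²) + λ_c(ν‖∇u‖² − ε) ≤ 0` a.e., then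
`2α ∫dE + 2β ∫dH + λ_b(A − energy) + λ_c(dissipation − ε) ≤ 0`. -/
theorem certificate_integral {ν : ℝ} {N : ℕ} {μ : Measure H3} [IsProbabilityMeasure μ]
    (hlev : ∀ᵐ u ∂μ, IsLevel N u) (h3 : Integrable (fun u : H3 => ‖u‖ ^ 3) μ)
    {R₀ dE dH : H3 → ℝ} (hR₀ : Integrable R₀ μ) (hR₀0 : ∫ u, R₀ u ∂μ = 0)
    (hdE : Integrable dE μ) (hdH : Integrable dH μ) {α β lb lc A ε : ℝ}
    (hcert : ∀ᵐ u ∂μ, R₀ u + 2 * α * dE u + 2 * β * dH u + lb * (A - ‖u‖ ^ 2) +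
        lc * (ν * (Torus.eGradNormSq ((u : L2T3) : T3 → R3)).toReal - ε) ≤ 0) :
    2 * α * (∫ u, dE u ∂μ) + 2 * β * (∫ u, dH u ∂μ) +
      lb * (A - Torus.ensembleEnergy μ) + lc * (Torus.ensembleDissipation ν μ - ε) ≤ 0 := by
  have h2 : Integrable (fun u : H3 => ‖u‖ ^ 2) μ :=
    integrable_norm_pow_of_cube h3 (by norm_num)
  set D : H3 → ℝ := fun u => (Torus.eGradNormSq ((u : L2T3) : T3 → R3)).toReal with hD
  have hDm : AEStronglyMeasurable D μ :=
    (Torus.measurable_eGradNormSq_coe (d := Fin 3)).ennreal_toReal.aestronglyMeasurable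
  have hDI : Integrable D μ := by
    refine Integrable.mono' (h2.const_mul (4 * Real.pi ^ 2 * (N : ℝ) ^ 2)) hDm
      (hlev.mono fun u hu => ?_)
    rw [Real.norm_eq_abs, abs_of_nonneg ENNReal.toReal_nonneg]
    have := ENNReal.toReal_mono ENNReal.ofReal_ne_top (eGradNormSq_le_of_isLevel hu)
    rwa [ENNReal.toReal_ofReal (by positivity)] at this
  have hDint : Torus.ensembleDissipation ν μ = ν * ∫ u, D u ∂μ := by
    unfold Torus.ensembleDissipation Torus.ensembleEnstrophy
    rw [integral_toReal (Torus.measurable_eGradNormSq_coe (d := Fin 3)).aemeasurable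
      (hlev.mono fun u hu => eGradNormSq_lt_top_of_isLevel hu)]
  have hE : Torus.ensembleEnergy μ = ∫ u, ‖u‖ ^ 2 ∂μ := rfl
  -- integrability of the partial sums
  have i2 : Integrable (fun u => 2 * α * dE u) μ := hdE.const_mul _
  have i3 : Integrable (fun u => 2 * β * dH u) μ := hdH.const_mul _
  have i4 : Integrable (fun u : H3 => lb * (A - ‖u‖ ^ 2)) μ :=
    ((integrable_const A).sub h2).const_mul lb
  have i5 : Integrable (fun u : H3 => lc * (ν * D u - ε)) μ :=
    ((hDI.const_mul ν).sub (integrable_const ε)).const_mul lc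
  have i12 : Integrable (fun u => R₀ u + 2 * α * dE u) μ := hR₀.add i2
  have i123 : Integrable (fun u => R₀ u + 2 * α * dE u + 2 * β * dH u) μ := i12.add i3
  have i1234 : Integrable (fun u : H3 => R₀ u + 2 * α * dE u + 2 * β * dH u +
      lb * (A - ‖u‖ ^ 2)) μ := i123.add i4
  have hint := integral_nonpos_of_ae hcert
  rw [integral_add i1234 i5, integral_add i123 i4, integral_add i12 i3, integral_add hR₀ i2,
    integral_const_mul, integral_const_mul, integral_const_mul, integral_const_mul,
    integral_sub (integrable_const A) h2, integral_sub (hDI.const_mul ν) (integrable_const ε),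
    integral_const_mul, integral_const, integral_const, hR₀0] at hint
  simp only [probReal_univ, one_smul] at hint
  rw [hDint, hE]
  linarith

end NoCasimirCertificate

end Summit.AnomalousDissipation.AnomalousDissipation.Theorems.MomentParityCubicParityLoud

end
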